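import Literature.NumberTheory.Transcendental.NesterenkoEliminationProp47ValuesProofs
import HarnessLib

/-!
# LNM 1752 Ch. 3 Corollary 4.12 from Proposition 4.11 — proofs only

`Literature/NumberTheory/Transcendental/NesterenkoEliminationCor412Proofs.lean` — proofs only (no
new definitions, nothing asserted). The named fact `NesterenkoPhilippon2001_ch3_cor_4_12`
(`NesterenkoEliminationFacts.lean`: Nesterenko's "small value" Bézout step, LNM 1752 Ch. 3
Cor. 4.12) DERIVED from the named fact `NesterenkoPhilippon2001_ch3_prop_4_11`
(`NesterenkoEliminationFacts2.lean`: Prop. 4.11, the Bézout inequality with the dichotomy `δ`),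
exactly as in print ("PROOF. See [Nes10, Corollary 3]": Proposition 4.11 applied to `Q = P^η`):

* `NesterenkoPhilippon2001_ch3_cor_4_12_of_prop_4_11 : prop_4_11 → cor_4_12`.

The two polynomial inequalities the printed proof uses for `Q = P^η` (`P` a form of degree `d` in
`x₀, …, x_m`, `K = ℚ`, `ν = 1`) are proved here:

* `height_pow_le` — `h(P^η) ≤ η (h(P) + m d)` ([Nes10] Lemma 1.2 / the remark that the number of
  monomials of a form of degree `d` in `m + 1` variables is at most `(d+1)^m ≤ e^{md}`; proved from
  the primitive integer representative of `P` (`NesterenkoIntegerHeights.lean`, Gauss's lemma) and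
  the trivial bound `|A B| ≤ #supp A · |A| |B|`);
* `maxNorm_pow_le_exp_mul` — Gelfond's inequality `|P|^η ≤ e^{η m d} |P^η|` for the maximum norm
  of the coefficients (`GelfondLemma.lean` through `sum_log_maxNorm_le`, after dehomogenising one
  variable with `NesterenkoBlockDehom.lean`, which is lossless on forms), whence
  `normAt_pow_le` — `‖P^η‖_ω̄ ≤ ‖P‖_ω̄^η e^{η m d}`.

With these, the printed argument runs: parts 1), 2) of Cor. 4.12 are parts 1), 2) of Prop. 4.11 for
`Q = P^η` (`deg Q = η deg P`, `h(Q) ≤ η(h(P) + m deg P)`, `m(r+1) + m ≤ m(r+2)`); for part 3) one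
shows `δ ≤ e^{−S}`: if `ρ ≥ ‖Q‖_ω̄` then `δ = |𝔭(ω̄)| ≤ e^{−S}` by hypothesis, and if `ρ < ‖Q‖_ω̄`
then `‖Q‖_ω̄ ≤ ‖P‖_ω̄^η e^{ηmd} ≤ ‖P‖_ω̄^{η/2}` (by `‖P‖_ω̄ ≤ e^{−2md}`), so
`‖Q‖_ω̄² ≤ ‖P‖_ω̄^η ≤ max(e^{−S}, ρ)²`, and `ρ < ‖Q‖_ω̄ ≤ max(e^{−S}, ρ)` forces the maximum to be
`e^{−S}`; finally `m + 11m² ≤ 12m²`. The zero sets agree because `V(P^η) = V(P)`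
(`projZeros_sup_span_pow`).

Consequence for the trust base of `Literature.Barriers.Schanuel.NesterenkoModularScope`
(Nesterenko 1996): Cor. 4.12 is no longer a leaf; both printed routes (Ch. 3 §5 via Thm 5.1, and
Philippon's criterion via `Philippon1986_mainCriterion_of_nesterenko`) now rest on the same three
elimination-theoretic facts Prop. 4.4, Prop. 4.11, Prop. 4.13 (plus the Ch. 10 multiplicity
estimate); see `Literature/Barriers/Schanuel/NesterenkoModularScopeAssembly.lean`.

Full proofs of Prop. 4.4, 4.11, 4.13 ([Nes10] §1, Prop. 1.1, 1.4, 1.5) are printed, besides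
[Nes10], in Zhu Yaochen, *Transcendental numbers: algebraic independence* (USTC Press), Ch. 2
(Prop. 2.1.1, 2.3.1, 2.3.3, with Appendix 2 on the elimination ideals); the derivation of Cor. 4.12
formalised here is his Prop. 2.3.2.

## References

* [NesterenkoPhilippon2001] Yu. V. Nesterenko, in LNM 1752 (2001), Ch. 3 §4, Prop. 4.11 and
  Cor. 4.12 (pp. 40–41); PDF page = book page + 12.
* [Nes10] Yu. V. Nesterenko, Proc. Steklov Inst. Math. 218 (1997) 294–331, §1, Lemma 1.2,
  Prop. 1.4, Corollary 3.
* [BombieriGubler2006] E. Bombieri, W. Gubler, *Heights in Diophantine Geometry*, Lemma 1.6.11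
  (Gelfond's lemma).
-/

noncomputable section

open MvPolynomial Real
open Literature.NumberTheory.DiophantineGeometry

namespace Literature.NumberTheory.Transcendental

namespace Nesterenko

/-! ### Generalities on `maxNorm` -/

section MaxNorm

variable {σ : Type*}

/-- `|·|` is unchanged by an injective renaming of the variables (same set of coefficients).
[folklore] -/
theorem maxNorm_rename_of_injective {τ K : Type*} [NormedField K] {f : σ → τ}
    (hf : Function.Injective f) (P : MvPolynomial σ K) : maxNorm (rename f P) = maxNorm P := by
  classical
  unfold maxNorm
  rw [support_rename_of_injective hf, Finset.sup_image]
  congr 1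
  refine Finset.sup_congr rfl fun e _ => ?_
  simp only [Function.comp_apply]
  rw [coeff_rename_mapDomain f hf]

/-- `|·|` is unchanged by extending the coefficients from `ℚ` to `ℂ`. [folklore] -/
theorem maxNorm_map_algebraMap (P : MvPolynomial σ ℚ) :
    maxNorm (map (algebraMap ℚ ℂ) P) = maxNorm P := by
  classical
  unfold maxNorm
  rw [support_map_of_injective P (algebraMap ℚ ℂ).injective]
  congr 1
  refine Finset.sup_congr rfl fun e _ => ?_
  rw [coeff_map]
  ext
  push_cast
  exact norm_ratCast_eq _

/-- `|A^k| ≤ (#supp A · |A|)^k`. [folklore] -/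
theorem maxNorm_pow_le_card_mul_pow {K : Type*} [NormedField K] (A : MvPolynomial σ K) (k : ℕ) :
    maxNorm (A ^ k) ≤ (A.support.card * maxNorm A) ^ k := by
  induction k with
  | zero => simpa using (maxNorm_one_le (σ := σ) (K := K))
  | succ k ih =>
    rw [pow_succ', pow_succ']
    calc maxNorm (A * A ^ k) ≤ A.support.card * maxNorm A * maxNorm (A ^ k) := maxNorm_mul_le _ _
      _ ≤ A.support.card * maxNorm A * (A.support.card * maxNorm A) ^ k :=
          mul_le_mul_of_nonneg_left ih (mul_nonneg (Nat.cast_nonneg _) (maxNorm_nonneg _))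

end MaxNorm

/-! ### Forms: the exponents of a monomial, dehomogenising one variable -/

section Forms

variable {σ R : Type*} [CommSemiring R] [Fintype σ]

/-- The exponents of a monomial of a form of degree `d` sum to `d` (any finite set of variables,
any coefficients). [folklore] -/
theorem sum_univ_eq_of_isHomogeneous {A : MvPolynomial σ R} {d : ℕ} (hA : A.IsHomogeneous d)
    {s : σ →₀ ℕ} (hs : s ∈ A.support) : ∑ i, s i = d := by
  have h := hA (mem_support_iff.mp hs)
  rw [Finsupp.weight_apply, Finsupp.sum_fintype _ _ (fun _ => by simp)] at h
  simpa using h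

end Forms

section Dehom

variable {m : ℕ} {K : Type*} [Field K]

/-- `j ↦ (0, j)` is injective. [folklore] -/
theorem prodMk_zero_injective : Function.Injective (Prod.mk (0 : Fin 1) : Fin (m + 1) → _) :=
  fun _ _ h => (Prod.mk.inj h).2

/-- A form of degree `d` in `x₀, …, x_m`, viewed as a polynomial in ONE block of variables
`Fin 1 × Fin (m+1)` (through `rename (Prod.mk 0)`), is block-homogeneous of block degree `d`, so
that the dehomogenisation `dehom` of `NesterenkoBlockDehom.lean` applies to it. [folklore] -/
theorem rename_prodMk_blockHom {P : MvPolynomial (Fin (m + 1)) K} {d : ℕ}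
    (hP : P.IsHomogeneous d) :
    ∀ e ∈ (rename (Prod.mk (0 : Fin 1)) P).support, ∀ i : Fin 1, ∑ a, e (i, a) = d := by
  classical
  intro e he i
  rw [support_rename_of_injective prodMk_zero_injective, Finset.mem_image] at he
  obtain ⟨s, hs, rfl⟩ := he
  have hi : i = 0 := Subsingleton.elim _ _
  subst hi
  simp_rw [Finsupp.mapDomain_apply prodMk_zero_injective]
  exact sum_univ_eq_of_isHomogeneous hP hs

/-- On forms the dehomogenisation at `x₀` is lossless: the exponent map is injective on the
support. [folklore] -/
theorem injOn_dehomIdx_rename_prodMk {P : MvPolynomial (Fin (m + 1)) K} {d : ℕ}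
    (hP : P.IsHomogeneous d) :
    Set.InjOn (dehomIdx (r := 1) (0 : Fin (m + 1))) (rename (Prod.mk (0 : Fin 1)) P).support :=
  injOn_dehomIdx 0 (S := ((rename (Prod.mk (0 : Fin 1)) P).support : Set _)) (D := fun _ => d)
    fun e he i => rename_prodMk_blockHom hP e he i

/-- A non-zero form stays non-zero after dehomogenising `x₀`. [folklore] -/
theorem dehom_rename_ne_zero {P : MvPolynomial (Fin (m + 1)) K} {d : ℕ} (hP : P.IsHomogeneous d)
    (hP0 : P ≠ 0) : dehom K (0 : Fin (m + 1)) (rename (Prod.mk (0 : Fin 1)) P) ≠ 0 := by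
  refine dehom_ne_zero 0 (injOn_dehomIdx_rename_prodMk hP) ?_
  exact fun h => hP0 (rename_injective _ prodMk_zero_injective (by rw [map_zero]; exact h))

/-- Every partial degree of the dehomogenised form is at most `d`. [folklore] -/
theorem degreeOf_dehom_rename_le {P : MvPolynomial (Fin (m + 1)) K} {d : ℕ}
    (hP : P.IsHomogeneous d) (v : Fin 1 × {a : Fin (m + 1) // a ≠ 0}) :
    degreeOf v (dehom K (0 : Fin (m + 1)) (rename (Prod.mk (0 : Fin 1)) P)) ≤ d :=
  degreeOf_dehom_le 0 _ (D := fun _ => d) (rename_prodMk_blockHom hP) v.1 v.2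

/-- The dehomogenised form has as many monomials. [folklore] -/
theorem card_support_dehom_rename {P : MvPolynomial (Fin (m + 1)) K} {d : ℕ}
    (hP : P.IsHomogeneous d) :
    (dehom K (0 : Fin (m + 1)) (rename (Prod.mk (0 : Fin 1)) P)).support.card = P.support.card := by
  classical
  rw [card_support_dehom 0 _ (injOn_dehomIdx_rename_prodMk hP),
    support_rename_of_injective prodMk_zero_injective,
    Finset.card_image_of_injective _ (Finsupp.mapDomain_injective prodMk_zero_injective)]

/-- **A form of degree `d` in `m + 1` variables has at most `(d+1)^m` monomials.** [folklore] -/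
theorem card_support_le_succ_pow_of_isHomogeneous {P : MvPolynomial (Fin (m + 1)) K} {d : ℕ}
    (hP : P.IsHomogeneous d) : P.support.card ≤ (d + 1) ^ m := by
  classical
  rw [← card_support_dehom_rename hP]
  refine (card_support_le_prod_degreeOf_succ' _).trans ?_
  calc ∏ v, (degreeOf v (dehom K (0 : Fin (m + 1)) (rename (Prod.mk (0 : Fin 1)) P)) + 1)
      ≤ ∏ _v : Fin 1 × {a : Fin (m + 1) // a ≠ 0}, (d + 1) :=
        Finset.prod_le_prod' fun v _ => Nat.succ_le_succ (degreeOf_dehom_rename_le hP v)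
    _ = (d + 1) ^ m := by
        rw [Finset.prod_const, Finset.card_univ, card_blockVars, one_mul]

/-- `|P(1, x₁, …, x_m)| = |P|` for a form over a normed field. [folklore] -/
theorem maxNorm_dehom_rename {K : Type*} [NormedField K] {P : MvPolynomial (Fin (m + 1)) K}
    {d : ℕ} (hP : P.IsHomogeneous d) :
    maxNorm (dehom K (0 : Fin (m + 1)) (rename (Prod.mk (0 : Fin 1)) P)) = maxNorm P := by
  rw [maxNorm_dehom 0 _ (injOn_dehomIdx_rename_prodMk hP),
    maxNorm_rename_of_injective prodMk_zero_injective]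

end Dehom

/-! ### Gelfond's inequality for powers of a form -/

section Gelfond

variable {m : ℕ}

/-- **Gelfond's inequality for a power of a form** (`K = ℚ`, archimedean absolute value): for a
form `P ≠ 0` of degree `d` in `x₀, …, x_m`, `|P|^η ≤ e^{η m d} |P^η|`
(`|·|` = maximum modulus of the coefficients). [Nes10] Lemma 1.2 / Bombieri–Gubler Lemma 1.6.11,
applied after dehomogenising `x₀` (lossless on forms), so that only `m` partial degrees `≤ d` are
charged. [cite: BombieriGubler2006, §1.6, Lemma 1.6.11] -/
theorem maxNorm_pow_le_exp_mul (P : Rx m) {d : ℕ} (hP : P.IsHomogeneous d) (hP0 : P ≠ 0)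
    (η : ℕ) : maxNorm P ^ η ≤ Real.exp ((η : ℝ) * m * d) * maxNorm (P ^ η) := by
  classical
  -- pass to `ℂ` and dehomogenise
  set PC : MvPolynomial (Fin (m + 1)) ℂ := map (algebraMap ℚ ℂ) P with hPCdef
  have hPChom : PC.IsHomogeneous d := hP.map _
  have hPC0 : PC ≠ 0 := fun h =>
    hP0 (map_injective _ (algebraMap ℚ ℂ).injective (by rw [map_zero]; exact h))
  have hPCη : (PC ^ η).IsHomogeneous (d * η) := hPChom.pow η
  set B := dehom ℂ (0 : Fin (m + 1)) (rename (Prod.mk (0 : Fin 1)) PC) with hB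
  have hB0 : B ≠ 0 := dehom_rename_ne_zero hPChom hPC0
  have hBnorm : maxNorm B = maxNorm P := by
    rw [hB, maxNorm_dehom_rename hPChom, hPCdef, maxNorm_map_algebraMap]
  have hBηnorm : maxNorm (B ^ η) = maxNorm (P ^ η) := by
    rw [hB, ← map_pow, ← map_pow, maxNorm_dehom_rename hPCη, hPCdef,
      ← map_pow (MvPolynomial.map _), maxNorm_map_algebraMap]
  have hBdeg : ∀ v, degreeOf v B ≤ d := degreeOf_dehom_rename_le hPChom
  -- Gelfond's lemma for `η` copies of `B`
  have h := sum_log_maxNorm_le (Finset.range η) (fun _ => B) fun _ _ => hB0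
  simp only [Finset.prod_const, Finset.card_range, Finset.sum_const, nsmul_eq_mul] at h
  have hdeg : ∑ v : Fin 1 × {a : Fin (m + 1) // a ≠ 0}, ((η : ℝ) * (degreeOf v B : ℝ)) ≤
      (η : ℝ) * m * d := by
    calc ∑ v : Fin 1 × {a : Fin (m + 1) // a ≠ 0}, ((η : ℝ) * (degreeOf v B : ℝ))
        ≤ ∑ _v : Fin 1 × {a : Fin (m + 1) // a ≠ 0}, ((η : ℝ) * d) :=
          Finset.sum_le_sum fun v _ =>
            mul_le_mul_of_nonneg_left (by exact_mod_cast hBdeg v) (Nat.cast_nonneg _)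
      _ = (η : ℝ) * m * d := by
          rw [Finset.sum_const, Finset.card_univ, card_blockVars, nsmul_eq_mul]
          push_cast
          ring
  rw [hBnorm, hBηnorm] at h
  -- exponentiate
  have hPpos : 0 < maxNorm P := maxNorm_pos hP0
  have hPηpos : 0 < maxNorm (P ^ η) := maxNorm_pos (pow_ne_zero _ hP0)
  rw [← Real.log_le_log_iff (pow_pos hPpos _) (mul_pos (Real.exp_pos _) hPηpos),
    Real.log_pow, Real.log_mul (Real.exp_pos _).ne' hPηpos.ne', Real.log_exp]
  linarith

/-- **`‖P^η‖_ω̄ ≤ ‖P‖_ω̄^η · e^{η m d}`** for a form `P ≠ 0` of degree `d` and `ω̄ ≠ 0`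
(from `maxNorm_pow_le_exp_mul`; in print: "`−log ‖Q‖_ω̄ ≥ −η log ‖P‖_ω̄ − νηm deg P`").
[cite: NesterenkoPhilippon2001, Ch. 3 Cor. 4.12, proof = [Nes10, Cor. 3]] -/
theorem normAt_pow_le (P : Rx m) {d : ℕ} (hP : P.IsHomogeneous d) (hP0 : P ≠ 0)
    {ω : Fin (m + 1) → ℂ} (hω : ω ≠ 0) (η : ℕ) :
    normAt ω (P ^ η) ≤ normAt ω P ^ η * Real.exp ((η : ℝ) * m * d) := by
  have hw : 0 < ‖ω‖ := norm_pos_iff.mpr hω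
  have hPpos : 0 < maxNorm P := maxNorm_pos hP0
  have hPηpos : 0 < maxNorm (P ^ η) := maxNorm_pos (pow_ne_zero _ hP0)
  have htd : P.totalDegree = d := hP.totalDegree hP0
  have htdη : (P ^ η).totalDegree = d * η := (hP.pow η).totalDegree (pow_ne_zero _ hP0)
  unfold normAt
  rw [htd, htdη, map_pow, norm_pow, div_pow, mul_pow, ← pow_mul]
  -- `a^η / (|P^η| w) ≤ a^η / (|P|^η w) · e^{ηmd}` because `|P|^η ≤ e^{ηmd} |P^η|`
  have hG := maxNorm_pow_le_exp_mul P hP hP0 η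
  have ha : 0 ≤ ‖aeval ω P‖ ^ η := pow_nonneg (norm_nonneg _) _
  rw [div_mul_eq_mul_div, div_le_div_iff₀ (mul_pos hPηpos (pow_pos hw _))
    (mul_pos (pow_pos hPpos _) (pow_pos hw _))]
  have hwpos : 0 ≤ ‖ω‖ ^ (d * η) := (pow_pos hw _).le
  calc ‖aeval ω P‖ ^ η * (maxNorm P ^ η * ‖ω‖ ^ (d * η))
      = ‖aeval ω P‖ ^ η * ‖ω‖ ^ (d * η) * maxNorm P ^ η := by ring
    _ ≤ ‖aeval ω P‖ ^ η * ‖ω‖ ^ (d * η) * (Real.exp ((η : ℝ) * m * d) * maxNorm (P ^ η)) :=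
        mul_le_mul_of_nonneg_left hG (mul_nonneg ha hwpos)
    _ = ‖aeval ω P‖ ^ η * Real.exp ((η : ℝ) * m * d) * (maxNorm (P ^ η) * ‖ω‖ ^ (d * η)) := by
        ring

end Gelfond

/-! ### Heights of powers -/

section Heights

variable {m : ℕ}

/-- **`h(P^η) ≤ η (h(P) + log #supp P)`** for `0 ≠ P ∈ ℚ[T]` (primitive representative, Gauss's
lemma for powers, and `|A B| ≤ #supp A · |A| · |B|`). [folklore] -/
theorem height_pow_le_card {σ : Type*} (P : MvPolynomial σ ℚ) (hP0 : P ≠ 0) (η : ℕ) :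
    height (P ^ η) ≤ η * (height P + Real.log P.support.card) := by
  classical
  obtain ⟨c, hc, Z, hPZ, hsupp, hprim⟩ := exists_eq_C_mul_map_primitive P hP0
  set ZQ : MvPolynomial σ ℚ := map (Int.castRingHom ℚ) Z with hZQ
  have hinj : Function.Injective (Int.castRingHom ℚ) := Int.cast_injective
  have hZ0 : Z ≠ 0 := ne_zero_of_gcd_coeff_eq_one hprim
  -- `h(P) = h(Z)`, `h(P^η) = h(Z^η)`
  have hhP : height P = height ZQ := by rw [hPZ, height_C_mul hc]
  have hPη : P ^ η = C (c ^ η) * map (Int.castRingHom ℚ) (Z ^ η) := by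
    rw [hPZ, mul_pow, ← map_pow C, ← map_pow (MvPolynomial.map _)]
  have hhPη : height (P ^ η) = height (map (Int.castRingHom ℚ) (Z ^ η)) := by
    rw [hPη, height_C_mul (pow_ne_zero _ hc)]
  -- `Z^η` is primitive; its height is `log` of a maximal coefficient
  have hprimη := gcd_coeff_pow_eq_one hprim η
  have hZη0 : Z ^ η ≠ 0 := pow_ne_zero _ hZ0
  obtain ⟨γ, hγ, hγmax⟩ := Finset.exists_max_image (Z ^ η).support (fun δ => |coeff δ (Z ^ η)|)
    (by rw [Finset.nonempty_iff_ne_empty, Ne, support_eq_empty]; exact hZη0)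
  have hhZη : height (map (Int.castRingHom ℚ) (Z ^ η)) = Real.log (|coeff γ (Z ^ η)| : ℤ) :=
    height_map_eq_log_abs_coeff _ hprimη hγ hγmax
  -- and that coefficient is bounded by `|ZQ^η| ≤ (#supp · |ZQ|)^η`
  have hcoeff_le : ((|coeff γ (Z ^ η)| : ℤ) : ℝ) ≤ maxNorm (ZQ ^ η) := by
    have h := norm_coeff_le_maxNorm (ZQ ^ η) γ
    rw [hZQ, ← map_pow (MvPolynomial.map _), coeff_map, eq_intCast] at h
    rw [Int.cast_abs]
    have : ‖((coeff γ (Z ^ η) : ℤ) : ℚ)‖ = |((coeff γ (Z ^ η) : ℤ) : ℝ)| := by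
      rw [← Rat.norm_cast_real, Real.norm_eq_abs]
      push_cast
      rfl
    rw [this] at h
    rwa [hZQ, ← map_pow (MvPolynomial.map _)]
  have hcoeff_pos : (0 : ℝ) < ((|coeff γ (Z ^ η)| : ℤ) : ℝ) := by
    exact_mod_cast abs_pos.mpr (mem_support_iff.mp hγ)
  -- `h(ZQ) = log |ZQ|`
  obtain ⟨γ₀, hγ₀, hγ₀max⟩ := Finset.exists_max_image Z.support (fun δ => |coeff δ Z|)
    (by rw [Finset.nonempty_iff_ne_empty, Ne, support_eq_empty]; exact hZ0)
  have hhZ : height ZQ = Real.log (|coeff γ₀ Z| : ℤ) := height_map_eq_log_abs_coeff _ hprim hγ₀ hγ₀max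
  have hZQ0 : ZQ ≠ 0 := fun h => hZ0 (map_injective _ hinj (by rw [map_zero]; exact h))
  have hnormZ : maxNorm ZQ = ((|coeff γ₀ Z| : ℤ) : ℝ) := by
    obtain ⟨e, he, heq⟩ := exists_norm_coeff_eq_maxNorm hZQ0
    have habs : ∀ δ, ‖coeff δ ZQ‖ = (((|coeff δ Z| : ℤ) : ℝ)) := fun δ => by
      rw [hZQ, coeff_map, eq_intCast, Int.cast_abs, ← Rat.norm_cast_real, Real.norm_eq_abs]
      push_cast
      rfl
    refine le_antisymm ?_ ?_
    · rw [← heq, habs]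
      have he' : e ∈ Z.support := by rwa [hZQ, support_map_of_injective Z hinj] at he
      exact_mod_cast hγ₀max e he'
    · rw [← habs]
      exact norm_coeff_le_maxNorm _ _
  have hZpos : 0 < maxNorm ZQ := maxNorm_pos hZQ0
  have hcardZ : ZQ.support.card = P.support.card := by
    rw [hZQ, support_map_of_injective Z hinj, hsupp]
  -- assemble
  have hpow := maxNorm_pow_le_card_mul_pow ZQ η
  have hcard_pos : (0 : ℝ) < ZQ.support.card := by
    have : ZQ.support.Nonempty := by
      rw [Finset.nonempty_iff_ne_empty, Ne, support_eq_empty]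
      exact hZQ0
    exact_mod_cast this.card_pos
  rw [hhPη, hhZη, hhP, hhZ, ← hnormZ, ← hcardZ]
  calc Real.log ((|coeff γ (Z ^ η)| : ℤ) : ℝ) ≤ Real.log (maxNorm (ZQ ^ η)) :=
        Real.log_le_log hcoeff_pos hcoeff_le
    _ ≤ Real.log ((ZQ.support.card * maxNorm ZQ) ^ η) :=
        Real.log_le_log (hcoeff_pos.trans_le hcoeff_le) hpow
    _ = η * (Real.log (maxNorm ZQ) + Real.log ZQ.support.card) := by
        rw [Real.log_pow, Real.log_mul hcard_pos.ne' hZpos.ne']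
        ring

/-- **`h(P^η) ≤ η (h(P) + m d)`** for a form `P ≠ 0` of degree `d` in `x₀, …, x_m` over `ℚ`
(in print: "`h(Q) ≤ η h(P) + νm deg Q = η(h(P) + νm deg P)`", [Nes10] Lemma 1.2): from
`height_pow_le_card` and `#supp P ≤ (d+1)^m ≤ e^{md}`.
[cite: NesterenkoPhilippon2001, Ch. 3 Cor. 4.12, proof = [Nes10, Cor. 3]] -/
theorem height_pow_le (P : Rx m) {d : ℕ} (hP : P.IsHomogeneous d) (hP0 : P ≠ 0) (η : ℕ) :
    height (P ^ η) ≤ η * (height P + m * d) := by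
  have h1 := height_pow_le_card P hP0 η
  have hcard : P.support.card ≤ (d + 1) ^ m := card_support_le_succ_pow_of_isHomogeneous hP
  have hcard_pos : (0 : ℝ) < P.support.card := by
    have : P.support.Nonempty := by
      rw [Finset.nonempty_iff_ne_empty, Ne, support_eq_empty]
      exact hP0
    exact_mod_cast this.card_pos
  have hlog : Real.log P.support.card ≤ m * d := by
    calc Real.log P.support.card ≤ Real.log (((d : ℝ) + 1) ^ m) :=
          Real.log_le_log hcard_pos (by exact_mod_cast hcard)
      _ = m * Real.log ((d : ℝ) + 1) := by rw [Real.log_pow]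
      _ ≤ m * d := by
          refine mul_le_mul_of_nonneg_left ?_ (Nat.cast_nonneg _)
          have h := Real.add_one_le_exp (d : ℝ)
          calc Real.log ((d : ℝ) + 1) ≤ Real.log (Real.exp d) :=
                Real.log_le_log (by positivity) h
            _ = d := Real.log_exp _
  calc height (P ^ η) ≤ η * (height P + Real.log P.support.card) := h1
    _ ≤ η * (height P + m * d) := by
        refine mul_le_mul_of_nonneg_left ?_ (Nat.cast_nonneg _)
        linarith

end Heights

/-! ### Zeros of `(𝔭, P^η)` -/

section Zeros

variable {m : ℕ}

/-- `V(I + (Q)) = V(I) ∩ {Q = 0}`. [folklore] -/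
theorem mem_projZeros_sup_span_singleton_iff (I : Ideal (Rx m)) (Q : Rx m) (β : Fin (m + 1) → ℂ) :
    β ∈ projZeros (I ⊔ Ideal.span {Q}) ↔ β ∈ projZeros I ∧ aeval β Q = 0 := by
  constructor
  · rintro ⟨hβ, h⟩
    exact ⟨⟨hβ, fun R hR => h R (Ideal.mem_sup_left hR)⟩,
      h Q (Ideal.mem_sup_right (Ideal.subset_span rfl))⟩
  · rintro ⟨⟨hβ, hI⟩, hQ⟩
    refine ⟨hβ, fun R hR => ?_⟩
    obtain ⟨a, ha, b, hb, rfl⟩ := Submodule.mem_sup.mp hR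
    obtain ⟨c, rfl⟩ := Ideal.mem_span_singleton'.mp hb
    rw [map_add, map_mul, hI a ha, hQ, mul_zero, add_zero]

/-- **`V((𝔭, P^η)) = V((𝔭, P))`** for `η ≥ 1`. [folklore] -/
theorem projZeros_sup_span_pow (I : Ideal (Rx m)) (P : Rx m) {η : ℕ} (hη : η ≠ 0) :
    projZeros (I ⊔ Ideal.span {P ^ η}) = projZeros (I ⊔ Ideal.span {P}) := by
  ext β
  rw [mem_projZeros_sup_span_singleton_iff, mem_projZeros_sup_span_singleton_iff, map_pow,
    pow_eq_zero_iff hη]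

end Zeros

/-! ### Corollary 4.12 from Proposition 4.11 -/

section Main

variable {m : ℕ}

/-- The key estimate of the printed proof: under the hypotheses of Corollary 4.12 the quantity `δ`
of Proposition 4.11 for `Q = P^η` satisfies `δ ≤ e^{−S}`. If `ρ ≥ ‖Q‖_ω̄` this is the hypothesis
`|𝔭(ω̄)| ≤ e^{−S}`; if `ρ < ‖Q‖_ω̄` then `‖Q‖_ω̄ ≤ ‖P‖_ω̄^η e^{ηmd} ≤ ‖P‖_ω̄^{η/2}`, so
`‖Q‖_ω̄ ≤ max(e^{−S}, ρ)`, and `ρ < ‖Q‖_ω̄` forces `max(e^{−S}, ρ) = e^{−S}`.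
[cite: NesterenkoPhilippon2001, Ch. 3 Cor. 4.12, proof = [Nes10, Cor. 3]] -/
theorem bezoutDelta_pow_le_exp_neg {𝔭 : Ideal (Rx m)} {r : ℕ} {P : Rx m} {d : ℕ}
    (hP : P.IsHomogeneous d) (hP0 : P ≠ 0) {ω : Fin (m + 1) → ℂ} (hω : ω ≠ 0) {S : ℝ} {η : ℕ}
    (hiabs : iabs 𝔭 r ω ≤ Real.exp (-S))
    (hsmall : normAt ω P ≤ Real.exp (-(2 * (m : ℝ) * d)))
    (hmain : normAt ω P ^ η ≤ max (Real.exp (-S)) (rho ω 𝔭) ^ 2) :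
    bezoutDelta 𝔭 r (P ^ η) ω ≤ Real.exp (-S) := by
  by_cases hlt : rho ω 𝔭 < normAt ω (P ^ η)
  · rw [bezoutDelta_of_lt hlt]
    set q := normAt ω (P ^ η) with hq
    set p := normAt ω P with hp
    have hp0 : 0 ≤ p := normAt_nonneg _ _
    have hq0 : 0 ≤ q := normAt_nonneg _ _
    have hM0 : 0 ≤ max (Real.exp (-S)) (rho ω 𝔭) := le_max_of_le_left (Real.exp_pos _).le
    -- `q ≤ p^η e^{ηmd}` and `p^η e^{2ηmd} ≤ 1`
    have h1 : q ≤ p ^ η * Real.exp ((η : ℝ) * m * d) := normAt_pow_le P hP hP0 hω η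
    have h2 : p ^ η * Real.exp (2 * ((η : ℝ) * m * d)) ≤ 1 := by
      have h := pow_le_pow_left₀ hp0 hsmall η
      rw [← Real.exp_nat_mul] at h
      calc p ^ η * Real.exp (2 * ((η : ℝ) * m * d))
          ≤ Real.exp (η * -(2 * (m : ℝ) * d)) * Real.exp (2 * ((η : ℝ) * m * d)) :=
            mul_le_mul_of_nonneg_right h (Real.exp_pos _).le
        _ = 1 := by rw [← Real.exp_add]; convert Real.exp_zero using 2; ring
    -- hence `q² ≤ p^η ≤ max(…)²`
    have h3 : q ^ 2 ≤ max (Real.exp (-S)) (rho ω 𝔭) ^ 2 := by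
      calc q ^ 2 ≤ (p ^ η * Real.exp ((η : ℝ) * m * d)) ^ 2 := pow_le_pow_left₀ hq0 h1 2
        _ = p ^ η * (p ^ η * Real.exp (2 * ((η : ℝ) * m * d))) := by
            rw [mul_pow, ← Real.exp_nat_mul]; push_cast; ring
        _ ≤ p ^ η * 1 := mul_le_mul_of_nonneg_left h2 (pow_nonneg hp0 _)
        _ ≤ max (Real.exp (-S)) (rho ω 𝔭) ^ 2 := by rw [mul_one]; exact hmain
    have h4 : q ≤ max (Real.exp (-S)) (rho ω 𝔭) := (sq_le_sq₀ hq0 hM0).mp h3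
    -- the maximum is `e^{-S}` (otherwise `ρ < q ≤ ρ`)
    rcases le_total (rho ω 𝔭) (Real.exp (-S)) with hle | hle
    · rwa [max_eq_left hle] at h4
    · rw [max_eq_right hle] at h4
      exact absurd (hlt.trans_le h4) (lt_irrefl _)
  · rw [bezoutDelta_of_le (not_lt.mp hlt)]
    exact hiabs

/-- **LNM 1752 Ch. 3 Corollary 4.12 ⇐ Proposition 4.11** (`K = ℚ`, `ν = 1`; "PROOF. See
[Nes10, Corollary 3]": Proposition 4.11 applied to `𝔭` and `Q = P^η`). The named fact
`NesterenkoPhilippon2001_ch3_cor_4_12` follows from the named fact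
`NesterenkoPhilippon2001_ch3_prop_4_11`. See the module docstring for the computation.
[cite: NesterenkoPhilippon2001, Ch. 3 Cor. 4.12 (p. 41), Prop. 4.11 (pp. 40–41)] -/
theorem NesterenkoPhilippon2001_ch3_cor_4_12_of_prop_4_11
    (h411 : NesterenkoPhilippon2001_ch3_prop_4_11) : NesterenkoPhilippon2001_ch3_cor_4_12 := by
  intro m r 𝔭 P d hr1 hrm h𝔭 h𝔭h hunm hP0 hPd hd1 hP𝔭 ω S η hω hS hη hiabs hsmall hmain
  -- `Q = P^η`
  have hQd : (P ^ η).IsHomogeneous (d * η) := hPd.pow η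
  have hQ1 : 1 ≤ d * η := Nat.one_le_iff_ne_zero.mpr (Nat.mul_ne_zero (Nat.one_le_iff_ne_zero.mp hd1) hη.ne')
  have hQ𝔭 : P ^ η ∉ 𝔭 := fun h => hP𝔭 (h𝔭.mem_of_pow_mem η h)
  obtain ⟨hA, hB⟩ := h411 m r 𝔭 (P ^ η) (d * η) hr1 hrm h𝔭 h𝔭h hunm hQd hQ1 hQ𝔭
  -- the numerical comparisons
  have hm1 : (1 : ℝ) ≤ m := by exact_mod_cast hr1.trans hrm
  have hD0 : (0 : ℝ) ≤ ideg 𝔭 r := Nat.cast_nonneg _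
  have hd0 : (0 : ℝ) ≤ d := Nat.cast_nonneg _
  have hη0 : (0 : ℝ) ≤ η := Nat.cast_nonneg _
  have hhP0 : 0 ≤ height P := height_nonneg _
  have hih0 : 0 ≤ iheight 𝔭 r := height_nonneg _
  have hhQ : height (P ^ η) ≤ η * (height P + m * d) := height_pow_le P hPd hP0 η
  have hδ : bezoutDelta 𝔭 r (P ^ η) ω ≤ Real.exp (-S) :=
    bezoutDelta_pow_le_exp_neg hPd hP0 hω hiabs hsmall hmain
  have hdη : ((d * η : ℕ) : ℝ) = (d : ℝ) * η := by push_cast; ring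
  -- exponent of part 3): `h(Q) deg 𝔭 + h(𝔭) deg Q + 11 m² deg 𝔭 deg Q ≤ η (h(𝔭) d + h(P) deg 𝔭 + 12 m² d deg 𝔭)`
  have hE : height (P ^ η) * ideg 𝔭 r + iheight 𝔭 r * ((d * η : ℕ) : ℝ) +
      11 * (m : ℝ) ^ 2 * ideg 𝔭 r * ((d * η : ℕ) : ℝ) ≤
      η * (iheight 𝔭 r * d + height P * ideg 𝔭 r + 12 * (m : ℝ) ^ 2 * d * ideg 𝔭 r) := by
    rw [hdη]
    have h1 : height (P ^ η) * ideg 𝔭 r ≤ η * (height P + m * d) * ideg 𝔭 r :=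
      mul_le_mul_of_nonneg_right hhQ hD0
    have h2 : (m : ℝ) * d * ideg 𝔭 r ≤ (m : ℝ) ^ 2 * d * ideg 𝔭 r := by
      have : (m : ℝ) ≤ (m : ℝ) ^ 2 := by nlinarith
      exact mul_le_mul_of_nonneg_right (mul_le_mul_of_nonneg_right this hd0) hD0
    nlinarith [mul_nonneg hη0 (sub_nonneg.mpr h2)]
  have hexp : bezoutDelta 𝔭 r (P ^ η) ω *
      Real.exp (height (P ^ η) * ideg 𝔭 r + iheight 𝔭 r * ((d * η : ℕ) : ℝ) +
        11 * (m : ℝ) ^ 2 * ideg 𝔭 r * ((d * η : ℕ) : ℝ)) ≤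
      Real.exp (-S + η * (iheight 𝔭 r * d + height P * ideg 𝔭 r +
        12 * (m : ℝ) ^ 2 * d * ideg 𝔭 r)) := by
    rw [Real.exp_add (-S)]
    exact mul_le_mul hδ (Real.exp_le_exp.mpr hE) (Real.exp_pos _).le (Real.exp_pos _).le
  refine ⟨fun hr2 => ?_, fun hr => ?_⟩
  · obtain ⟨J, hJh, hJu, hJz, hJdeg, hJht, hJabs⟩ := hA hr2
    refine ⟨J, hJh, hJu, ?_, ?_, ?_, (hJabs ω hω).trans hexp⟩
    · rw [hJz, projZeros_sup_span_pow 𝔭 P hη.ne']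
    · calc ideg J (r - 1) ≤ ideg 𝔭 r * (d * η) := hJdeg
        _ = η * ideg 𝔭 r * d := by ring
    · refine hJht.trans ?_
      rw [hdη]
      have h1 : height (P ^ η) * ideg 𝔭 r ≤ η * (height P + m * d) * ideg 𝔭 r :=
        mul_le_mul_of_nonneg_right hhQ hD0
      have hr0 : (0 : ℝ) ≤ r := Nat.cast_nonneg _
      nlinarith [mul_nonneg (mul_nonneg (mul_nonneg hη0 (Nat.cast_nonneg m)) hd0) hD0]
  · exact (hB hr ω hω).trans hexp

end Main

end Nesterenko

end Literature.NumberTheory.Transcendental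

end
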